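import Summits.QuantumFields.QCD.Theorems.CentreStabilisedCircleSlabToTorusRelabel
import Summits.QuantumFields.QCD.Theorems.CentreStabilisedCircleSlabToTorusGeometry

/-!
# `SlabToTorus` (stmt-QuantumFields-10529), part 3: the circle functional at `N_t = N_s`, `h = θ = 0`
# is the torus functional

Helper file for the route item `CentreStabilisedCircle.SlabToTorus`. With the closed transport
terms of part 2 (`sE`, `E`, `Ψ`, local notation) and the quark-variable bijection
`σ : FermiIdx N_f N ≃ CircleFermiIdx N_f N N` induced by `sE` (`Φ` on
`flavour × (site × colour × spin)`, conjugated by the two `Fintype.equivFin` enumerations), the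
doubled relabelling `mapτ = ExteriorAlgebra.map (LinearMap.funLeft ℂ ℂ (dbl σ).symm)` of part 1
carries

* the periodic Wilson–Dirac matrix to the twist-free circle Dirac matrix
  (`qcdCircleDirac_eq_reindex`: same formula, `γ`-matrix of the circle direction `= euclideanGamma 3`,
  all seam phases `= 1` at `θ = 0`);
* the fermionic Boltzmann factor to the circle one (`mapτ_fermiBoltzmann`), the Berezin integral to
  the Berezin integral (`berezin_mapτ`, unit Jacobian from part 1);
* torus observables placed by `onTorus` to circle observables placed by `onCircle`
  (`onCircle_eq_mapτ_onTorus`);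

so that, the Wilson weights agreeing up to the constant `e^{3β#P}` (part 2) and the Wilson measure
being the normalised weighted Haar measure, `qcdCircleExpect N N β 0 m 0 (mapτ ∘ X ∘ Ψ) =
qcdTorusExpect β N m X` (`qcdCircleExpect_eq_qcdTorusExpect`; both sides are the same ratio, the
normalisations cancel without any positivity of `Z(1)`) and finally
`qcdCircleConnectedCorr N N β 0 m 0 A B n = qcdLatticeConnectedCorr β N m A B n`
(`qcdCircleConnectedCorr_eq`). Routine bookkeeping ("folklore"; Osterwalder–Seiler 1978 §2 for the
functional, Montvay–Münster 1994 §4.1, §5.1 for the Wilson–Dirac action).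
-/

namespace Summit.QuantumFields.QCD.Theorems.CentreStabilisedCircleSlabToTorus

open MeasureTheory
open Literature.MathematicalPhysics.QuantumLattice Literature.MathematicalPhysics.QuantumFieldTheory
open Literature.Probability.LatticeModels (TorusSite Torus.proj)

local notation "𝔾" => Matrix.specialUnitaryGroup (Fin 3) ℂ

/-- The site bijection `ℤ_N × (ℤ/N)³ ≃ (ℤ/N)⁴` (local notation, as in part 2). -/
local notation "sE[" N "]" => (Fin.snocEquiv fun _ : Fin 4 => ZMod N : SlabGauge.Site 3 N N ≃ TorusSite 4 N)

/-- The link bijection torus → circle (local notation, as in part 2). -/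
local notation "E[" N "]" =>
  (Equiv.prodCongr (Equiv.symm (Fin.snocEquiv fun _ : Fin 4 => ZMod N)) (finSuccEquiv' (3 : Fin 4)) :
    TorusSite 4 N × Fin 4 ≃ SlabGauge.Site 3 N N × SlabGauge.Dir 3)

/-- The gauge-field bijection circle → torus (local notation, as in part 2). -/
local notation "Ψ[" N "]" =>
  (MeasurableEquiv.symm (MeasurableEquiv.piCongrLeft (fun _ : SlabGauge.Site 3 N N × SlabGauge.Dir 3 => 𝔾)
    (Equiv.prodCongr (Equiv.symm (Fin.snocEquiv fun _ : Fin 4 => ZMod N)) (finSuccEquiv' (3 : Fin 4)) :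
      TorusSite 4 N × Fin 4 ≃ SlabGauge.Site 3 N N × SlabGauge.Dir 3)))

/-- The quark-variable bijection torus → circle on `flavour × (site × colour × spin)` (local notation). -/
local notation "Φ[" Nf "," N "]" =>
  (Equiv.prodCongr (Equiv.refl (Fin Nf))
    (Equiv.prodCongr (Equiv.symm (Fin.snocEquiv fun _ : Fin 4 => ZMod N : SlabGauge.Site 3 N N ≃ TorusSite 4 N))
      (Equiv.refl (Fin 3 × Fin 4))) : QuarkVar Nf N ≃ CircleQuarkVar Nf N N)

/-- The induced bijection of the enumerated quark variables (local notation). -/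
local notation "σ[" Nf "," N "]" =>
  (Equiv.trans (Equiv.symm (quarkEquiv (Nf := Nf) (L := N))) (Equiv.trans (Φ[Nf,N])
    (circleQuarkEquiv (Nf := Nf) (Nt := N) (Ns := N))) : FermiIdx Nf N ≃ CircleFermiIdx Nf N N)

/-- The doubled bijection `ψ̄ᵢ ↦ ψ̄_{σ i}`, `ψᵢ ↦ ψ_{σ i}` of the generator labels (local notation). -/
local notation "τ[" Nf "," N "]" =>
  (Equiv.trans (Equiv.symm toLex) (Equiv.trans (Equiv.sumCongr σ[Nf,N] σ[Nf,N])
    (toLex : CircleFermiIdx Nf N N ⊕ CircleFermiIdx Nf N N ≃ CircleFermiIdx Nf N N ⊕ₗ CircleFermiIdx Nf N N)))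

/-- The relabelling algebra homomorphism `FermiAlg N_f N →ₐ CircleFermiAlg N_f N N` (local notation). -/
local notation "mapτ[" Nf "," N "]" =>
  (ExteriorAlgebra.map (LinearMap.funLeft ℂ ℂ (Equiv.symm τ[Nf,N])) :
    FermiAlg Nf N →ₐ[ℂ] CircleFermiAlg Nf N N)

variable {Nf N : ℕ} [NeZero N]

/-- `σ⁻¹ ∘ circleQuarkEquiv = quarkEquiv ∘ Φ⁻¹`. [folklore] -/
theorem σ_symm_circleQuarkEquiv (u : CircleQuarkVar Nf N N) :
    (σ[Nf,N]).symm (circleQuarkEquiv u) = quarkEquiv ((Φ[Nf,N]).symm u) := by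
  simp only [Equiv.symm_trans_apply, Equiv.symm_symm, Equiv.symm_apply_apply]

/-- `σ ∘ quarkEquiv = circleQuarkEquiv ∘ Φ`. [folklore] -/
theorem σ_quarkEquiv (y : QuarkVar Nf N) :
    σ[Nf,N] (quarkEquiv y) = circleQuarkEquiv (Φ[Nf,N] y) := by
  simp only [Equiv.trans_apply, Equiv.symm_apply_apply]

/-- **The twist-free circle Dirac matrix is the periodic Wilson–Dirac matrix, relabelled**:
`qcdCircleDirac U m 0 = reindex σ σ (diracMatrix (Ψ U) m)` — same Wilson formula (`r = 1`,
`γ_{axis μ}`), the seam phases being `1` at `θ = 0`. [folklore] -/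
theorem qcdCircleDirac_eq_reindex (U : QCDCircleConfig N N) (mq : Fin Nf → ℝ) :
    qcdCircleDirac U mq 0 = Matrix.reindex σ[Nf,N] σ[Nf,N] (diracMatrix (Ψ[N] U) mq) := by
  ext i j
  obtain ⟨v, rfl⟩ := circleQuarkEquiv.surjective i
  obtain ⟨w, rfl⟩ := circleQuarkEquiv.surjective j
  rw [Matrix.reindex_apply, Matrix.submatrix_apply, σ_symm_circleQuarkEquiv, σ_symm_circleQuarkEquiv]
  simp only [qcdCircleDirac, diracMatrix, Matrix.reindex_apply, Matrix.submatrix_apply,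
    Equiv.symm_apply_apply, Matrix.of_apply]
  have h1 : ∀ u : CircleQuarkVar Nf N N, ((Φ[Nf,N]).symm u).1 = u.1 := fun u => rfl
  have h2 : ∀ u : CircleQuarkVar Nf N N, ((Φ[Nf,N]).symm u).2 = (sE[N] u.2.1, u.2.2) := fun u => rfl
  simp only [h1, h2]
  by_cases hf : v.1 = w.1
  · rw [if_pos hf, if_pos hf, wilsonDirac, Matrix.of_apply]
    refine congrArg₂ (· - ·) ?_ ?_
    · simp only [Prod.mk.injEq, EmbeddingLike.apply_eq_iff_eq, mul_one]
      by_cases h : v.2 = w.2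
      · rw [if_pos h, if_pos (by rw [h]; exact ⟨rfl, rfl⟩)]
      · rw [if_neg h, if_neg (fun h' => h (Prod.ext h'.1 h'.2))]
    · refine congrArg₂ (· * ·) (by norm_num) ?_
      rw [← Equiv.sum_comp (finSuccEquiv' (3 : Fin 4)).symm]
      refine Finset.sum_congr rfl fun ν _ => ?_
      -- `simp` cannot descend below an applied matrix `M i j` (the type `Matrix` is not
      -- reducible), so the entries are aligned by `rw` first
      rw [finSuccEquiv'_symm_three, ← sE_shift, ← sE_shift, Ψ_apply_sE, Ψ_apply_sE, Complex.ofReal_one,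
        one_smul]
      simp only [Pi.zero_apply, flavourTwistPhase_zero, one_mul, inv_one, EmbeddingLike.apply_eq_iff_eq]
  · rw [if_neg hf, if_neg hf]

/-- **The relabelling carries the torus Boltzmann factor `e^{−ψ̄ D(ΨU) ψ}` to the circle one.** [folklore] -/
theorem mapτ_fermiBoltzmann (U : QCDCircleConfig N N) (mq : Fin Nf → ℝ) :
    mapτ[Nf,N] (fermiBoltzmann (Ψ[N] U) mq) = grassmannExp (quadratic ℂ (-qcdCircleDirac U mq 0)) := by
  rw [fermiBoltzmann, map_funLeft_grassmannExp, map_funLeft_dbl_quadratic, qcdCircleDirac_eq_reindex]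
  congr 2

/-- **The relabelling preserves the Berezin integral** (unit Jacobian, part 1). [folklore] -/
theorem berezin_mapτ (x : FermiAlg Nf N) :
    GrassmannAlgebra.berezin ℂ (CircleFermiIdx Nf N N ⊕ₗ CircleFermiIdx Nf N N) (mapτ[Nf,N] x) =
      fermiIntegral x :=
  berezin_map_funLeft_dbl ℂ (Fintype.card_congr Φ[Nf,N]) σ[Nf,N] x

/-- The doubled bijection on the label of a placed boxed quark variable: `τ (toTorusIdx N v w)` is
the label used by `onCircle`. [folklore] -/
theorem τ_toTorusIdx {R : ℕ} (v : Fin 4 → ℤ) (w : BoxFermiIdx Nf R ⊕ₗ BoxFermiIdx Nf R) :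
    τ[Nf,N] (QCDLatticeObservable.toTorusIdx N v w) =
      toLex (Sum.map (fun i => circleQuarkEquiv (circleQuarkVarOfBox N N v i))
        (fun i => circleQuarkEquiv (circleQuarkVarOfBox N N v i)) (ofLex w)) := by
  rcases w with i | i
  · change toLex (Sum.inl (σ[Nf,N] (quarkEquiv _))) = toLex (Sum.inl _)
    rw [σ_quarkEquiv]
    rfl
  · change toLex (Sum.inr (σ[Nf,N] (quarkEquiv _))) = toLex (Sum.inr _)
    rw [σ_quarkEquiv]
    rfl

/-- **Placing an observable on the circle lattice = placing it on the torus and relabelling**: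
`A.onCircle N N v U = mapτ (A.onTorus N v (Ψ U))`. [folklore] -/
theorem onCircle_eq_mapτ_onTorus {R : ℕ} (A : QCDLatticeObservable Nf R) (v : Fin 4 → ℤ)
    (U : QCDCircleConfig N N) :
    A.onCircle N N v U = mapτ[Nf,N] (A.onTorus N v (Ψ[N] U)) := by
  rw [QCDLatticeObservable.onCircle, QCDLatticeObservable.onTorus, ← AlgHom.comp_apply,
    ExteriorAlgebra.map_comp_map, torusLift_Ψ]
  congr 2
  refine LinearMap.pi_ext fun w c => ?_
  simp only [LinearMap.comp_apply, Fintype.linearCombination_apply_single, map_smul,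
    funLeft_symm_single, τ_toTorusIdx]

/-- The torus Wilson expectation as a normalised weighted Haar integral:
`∫ g dμ_W = Z⁻¹ ∫ e^{−β S_W} g dHaar`. [folklore] -/
theorem integral_wilsonMeasure_eq (β : ℝ) (g : GaugeConfig 4 N 𝔾 → ℂ) :
    ∫ V, g V ∂(wilsonMeasure (d := 4) (L := N) (fundamentalRep (Fin 3)) β) =
      (((partitionFunction (d := 4) (L := N) (fundamentalRep (Fin 3)) β)⁻¹.toReal : ℝ) : ℂ) *
        ∫ V, ((Real.exp (-β * wilsonAction (fundamentalRep (Fin 3)) V) : ℝ) : ℂ) * g V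
          ∂(Measure.pi fun _ : Edge 4 N => haarProbability 𝔾) := by
  have hmeas : Measurable fun V : GaugeConfig 4 N 𝔾 =>
      ENNReal.ofReal (Real.exp (-β * wilsonAction (fundamentalRep (Fin 3)) V)) :=
    (Real.measurable_exp.comp ((measurable_wilsonAction (fundamentalRep (Fin 3))
      (continuous_fundamentalRep (Fin 3))).const_mul _)).ennreal_ofReal
  rw [wilsonMeasure, integral_smul_measure, wilsonWeight,
    integral_withDensity_eq_integral_toReal_smul hmeas (ae_of_all _ fun _ => ENNReal.ofReal_lt_top),
    Complex.real_smul]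
  congr 1
  refine integral_congr_ae (ae_of_all _ fun V => ?_)
  dsimp only
  rw [ENNReal.toReal_ofReal (Real.exp_pos _).le, Complex.real_smul]

/-- The normalisation `Z⁻¹` of the torus Wilson measure is a non-zero real number. [folklore] -/
theorem toReal_inv_partitionFunction_ne_zero (β : ℝ) :
    ((partitionFunction (d := 4) (L := N) (fundamentalRep (Fin 3)) β)⁻¹).toReal ≠ 0 := by
  have h := (isProbabilityMeasure_wilsonMeasure (d := 4) (L := N) (fundamentalRep (Fin 3))
    (continuous_fundamentalRep (Fin 3)) β).measure_univ
  rw [wilsonMeasure, Measure.smul_apply, smul_eq_mul] at h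
  rw [ENNReal.toReal_ne_zero]
  refine ⟨fun h0 => ?_, fun ht => ?_⟩
  · rw [h0, zero_mul] at h
    exact zero_ne_one h
  · rw [ht] at h
    rcases eq_or_ne (wilsonWeight (d := 4) (L := N) (fundamentalRep (Fin 3)) β Set.univ) 0 with hw | hw
    · rw [hw, mul_zero] at h
      exact zero_ne_one h
    · rw [ENNReal.top_mul hw] at h
      exact ENNReal.top_ne_one h

/-- **The circle partition functional of a relabelled torus integrand**:
`Z_circle(mapτ ∘ X ∘ Ψ) = e^{3β#P} ∫ e^{−β S_W(V)} ∫dψ̄dψ X(V) e^{−ψ̄D(V)ψ} dHaar(V)`. [folklore] -/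
theorem qcdCirclePartition_eq (β : ℝ) (mq : Fin Nf → ℝ) (X : GaugeConfig 4 N 𝔾 → FermiAlg Nf N) :
    qcdCirclePartition (Nf := Nf) N N β 0 mq 0 (fun U => mapτ[Nf,N] (X (Ψ[N] U))) =
      ((Real.exp (β * (3 * Fintype.card (Plaquette 4 N))) : ℝ) : ℂ) *
        ∫ V, ((Real.exp (-β * wilsonAction (fundamentalRep (Fin 3)) V) : ℝ) : ℂ) *
          fermiIntegral (X V * fermiBoltzmann V mq) ∂(Measure.pi fun _ : Edge 4 N => haarProbability 𝔾) := by
  rw [qcdCirclePartition_deformation_zero, ← integral_const_mul, ← (measurePreserving_Ψ (N := N)).integral_comp']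
  refine integral_congr_ae (ae_of_all _ fun U => ?_)
  dsimp only
  rw [← mapτ_fermiBoltzmann, ← map_mul, berezin_mapτ, exp_neg_mul_wilsonAction_Ψ, Complex.ofReal_mul,
    ← mul_assoc, ← mul_assoc, ← Complex.ofReal_mul, ← Real.exp_add, add_neg_cancel, Real.exp_zero,
    Complex.ofReal_one, one_mul, mul_comm]

/-- **The centre-stabilised circle expectation at `N_t = N_s = N`, `h = 0`, `θ = 0` of a relabelled
torus integrand is the torus expectation**: `⟨mapτ ∘ X ∘ Ψ⟩_circle = ⟨X⟩_torus` (both are the same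
ratio; the constants `e^{3β#P}` and `Z⁻¹` cancel). [folklore] -/
theorem qcdCircleExpect_eq_qcdTorusExpect (β : ℝ) (mq : Fin Nf → ℝ)
    (X : GaugeConfig 4 N 𝔾 → FermiAlg Nf N) :
    qcdCircleExpect (Nf := Nf) N N β 0 mq 0 (fun U => mapτ[Nf,N] (X (Ψ[N] U))) =
      qcdTorusExpect β N mq X := by
  have h1 : (fun _ : QCDCircleConfig N N => (1 : CircleFermiAlg Nf N N)) =
      fun U => mapτ[Nf,N] ((fun _ : GaugeConfig 4 N 𝔾 => (1 : FermiAlg Nf N)) (Ψ[N] U)) :=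
    funext fun U => (map_one _).symm
  have hK : ((Real.exp (β * (3 * Fintype.card (Plaquette 4 N))) : ℝ) : ℂ) ≠ 0 :=
    Complex.ofReal_ne_zero.2 (Real.exp_pos _).ne'
  have hc : (((partitionFunction (d := 4) (L := N) (fundamentalRep (Fin 3)) β)⁻¹.toReal : ℝ) : ℂ) ≠ 0 :=
    Complex.ofReal_ne_zero.2 (toReal_inv_partitionFunction_ne_zero β)
  rw [qcdCircleExpect, h1, qcdCirclePartition_eq β mq X, qcdCirclePartition_eq β mq (fun _ => 1),
    mul_div_mul_left _ _ hK, qcdTorusExpect, integral_wilsonMeasure_eq, integral_wilsonMeasure_eq,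
    mul_div_mul_left _ _ hc]
  simp only [one_mul]

/-- **The connected correlations agree**: at `N_t = N_s = N`, `h = 0`, `θ = 0` the circle connected
correlation of `A, B` along the direction `0` is the torus connected Euclidean-time correlation,
`qcdCircleConnectedCorr N N β 0 m 0 A B n = qcdLatticeConnectedCorr β N m A B n`. [folklore] -/
theorem qcdCircleConnectedCorr_eq {R R' : ℕ} (β : ℝ) (mq : Fin Nf → ℝ) (A : QCDLatticeObservable Nf R)
    (B : QCDLatticeObservable Nf R') (n : ℕ) :
    qcdCircleConnectedCorr N N β 0 mq 0 A B n = qcdLatticeConnectedCorr β N mq A B n := by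
  have hAB : (fun U => A.onCircle N N 0 U * B.onCircle N N (Pi.single 0 (n : ℤ)) U) =
      fun U => mapτ[Nf,N] ((fun V => A.onTorus N 0 V * B.onTorus N (Pi.single 0 (n : ℤ)) V) (Ψ[N] U)) := by
    funext U
    rw [onCircle_eq_mapτ_onTorus, onCircle_eq_mapτ_onTorus, map_mul]
  have hA : A.onCircle N N 0 = fun U => mapτ[Nf,N] ((A.onTorus N 0) (Ψ[N] U)) :=
    funext fun U => onCircle_eq_mapτ_onTorus A 0 U
  have hB : B.onCircle N N (Pi.single 0 (n : ℤ)) =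
      fun U => mapτ[Nf,N] ((B.onTorus N (Pi.single 0 (n : ℤ))) (Ψ[N] U)) :=
    funext fun U => onCircle_eq_mapτ_onTorus B _ U
  rw [qcdCircleConnectedCorr, qcdLatticeConnectedCorr, hAB, hA, hB,
    qcdCircleExpect_eq_qcdTorusExpect β mq (fun V => A.onTorus N 0 V * B.onTorus N (Pi.single 0 (n : ℤ)) V),
    qcdCircleExpect_eq_qcdTorusExpect β mq (A.onTorus N 0),
    qcdCircleExpect_eq_qcdTorusExpect β mq (B.onTorus N (Pi.single 0 (n : ℤ)))]

end Summit.QuantumFields.QCD.Theorems.CentreStabilisedCircleSlabToTorus
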